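import Summits.QuantumFields.BalabanUV.Gaps.EndTopRunCriterion

/-!
# Gaps / EndUpperPerLevel — the use-site reading of the upper-bound letter (U) on the END roads: (D)'s END criterion and the W-β road
# `FlowStepRuns.endpointExistence_of_partialSums` hold with PER-LEVEL (k-dependent) upper bounds in place of the uniform `BetaUpperH β′ γ₀ β`
# (by TRUNCATION at the horizon, the tree's theorems used as black boxes), and under (G)'s letters (cooperative + Lipschitz in the last coupling)
# the per-level bound is automatic — a PORT into the tree, with attribution, of g1-plan-2 GEN 17's lens kernel
# `HOME/g1/skeletons/XreadHordFadingMemory_plan2.lean` (v1.8, sha16 4a2dd778a9e40b0b, §11 ∕ §12; lens item S-44 ∕ R-36 and its W-β addendum)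
# (cell pub-balaban-gaps, seat g1-p3 gen 7, row CAP+tail ∕ β-currency «split ∕ weakening»; file 1 of 4 of «the binder census of the END roads»)

HONEST FRAMING (cell rule, page 1 of everything): [folklore] real analysis over the tree's typed carriers (`FlowStep.HBeta` ∕ `Box` ∕ `RGEqH`,
`FlowStepRuns.BetaPartialSumsLowerH` ∕ `HaltsOutside` ∕ `CurriesHBeta`, `DagBinding.ForwardGenerated` ∕ `EndpointExistence` ∕ `modelOf`).
AUTHORSHIP: the mathematics and the Lean text of every declaration below are g1-plan-2 GEN 17's (planner seat; planners file nothing on the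
ledger by mandate — «provers may port»); this seat's contribution is the port (namespace, imports, this header, four one-line docstrings) and the
kernel re-check against the tree.  Every β-side hypothesis — (C) `BetaContH`, the per-level bounds, non-crossing `hord`, cooperative ∕ Lipschitz —
is a BINDER (a hypothesis SHAPE); for Bałaban's β the upper bound (U) is PRINTED UNIFORMLY ([I] §1 p. 264, (5.10)+(5.42)), so NO word of record
moves: the statements are about the hypothesis sets of the tree's END theorems.  `EndpointExistence` appears only as a conclusion of ∕ inside an
equivalence with hypotheses named in the signature.  NOTHING of Bałaban's is asserted; 0∕6 binders; 0 coefficients certified; one finite T⁴;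
NOT B12 Thm 2, NOT `BetaPertH`, NOT the continuum limit, NOT Clay.

THE POINT (g1-plan-2 S-44 ∕ R-36, verbatim in substance).  In (D) `EndTopRunCriterion.endpointExistence_iff_topRuns` the direction END ⟹ top-runs
uses the order letter only (`le_end_of_topRun`); top-runs ⟹ END uses (C) and (U) only through `EndRunwiseShooting.run_dichotomy`, where (U) enters
at ONE place, the seed `EndRunwiseShooting.seed_of_upper` — and the seed for horizon `K` meets `β_0, …, β_{K−1}` only.  So what the proof CONSUMES
is a bound on each `β_k` separately, «`∀ k, ∃ B_k, β_k ≤ B_k` on `Box γ k`», NOT uniformity in `k`.  §1 certifies this WITHOUT re-proving the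
shooting argument: the truncation `truncH β K` (`β_j` for `j < K`, `0` after) is uniformly bounded when `β` is per-level bounded, inherits (C),
non-crossing and the top-run bound, and its length-`K` runs ARE the `β`-runs of length `K`; (D) applied to `truncH β K` one horizon at a time
gives (D) for `β` under per-level bounds (`reachable_iff_topRuns_locUpper`, **`endpointExistence_iff_topRuns_locUpper`**, `…_modelOf_…`).  Under
(G)'s two letters (`Gaps/EndTopRunCooperative`: cooperative in the earlier couplings, Lipschitz `M` in the last, `M·γ₀³ < 2`) the per-level bound is
AUTOMATIC (`perLevelUpper_of_cooperative_lastLipschitz`: `β_k ≤ β_k(γ₀,…,γ₀) + M·γ₀`), so END ⟺ top-runs holds there with NO upper-bound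
binder — that corollary, which needs (H) `EndTopRunFadingMemory.hord_of_cooperative_lastLipschitz`, is the companion leaf
`Gaps/EndUpperFreeCooperative` (kept apart so that this leaf imports (D) only).  §2 (the W-β road): `FlowStepRuns.endpointExistence_of_partialSums` consumes (U) only in the IVT-window seed of `couplingTrajectory_exists_partialSums`, per
horizon, while `g⋆ = (1∕γ² + M)^{−1∕2}` is `β′`-free — hence **`endpointExistence_of_partialSums_locUpper`** (per-level bounds, no `0 ≤ β′`) and the
SIGN socket's per-level form `endpointExistence_of_sign_locUpper` (`M = 0`).  The companion witness leaf `Gaps/EndUpperLetterWitness` (file 4) shows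
a per-level bound IS load-bearing (g1-plan-2's blow-up family, N-16); uniformity in `k` is consumed by NO END socket of the tree.
0 sorry; ONE auxiliary function `truncH : HBeta → ℕ → HBeta` (no `def … : Prop`, no toy family); imports (D) `Gaps/EndTopRunCriterion` only
(which re-exports (A) `Gaps/EndRunwiseShooting` and `FlowStepRuns`); restates nothing of the tree.

CITATION HEADER (tags CONTEXT ONLY).  [I] = T. Bałaban, Commun. Math. Phys. **109** (1987) [Balaban1987RG1]: Thm 2 p. 259, (0.20) p. 256,
§1 pp. 263–264 ((U) printed uniformly).
-/

namespace Summit.QuantumFields.BalabanUV.Gaps.EndUpperPerLevel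

open Literature.MathematicalPhysics.QuantumFieldTheory.Balaban1983to89
open Literature.MathematicalPhysics.QuantumFieldTheory.Balaban1983to89.FlowStep
open Literature.MathematicalPhysics.QuantumFieldTheory.Balaban1983to89.FlowStepRuns
open Literature.MathematicalPhysics.QuantumFieldTheory.Balaban1983to89.DagBinding
open Summit.QuantumFields.BalabanUV.Gaps.EndRunwiseShooting
open Summit.QuantumFields.BalabanUV.Gaps.EndTopRunCriterion
open Finset

noncomputable section

/-! ## §1 (U) is consumed PER LEVEL: (D)'s END criterion with k-dependent upper bounds, by truncation; the per-level bound under (G)'s letters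
(g1-plan-2 kernel §11, ported) -/

/-- PER-LEVEL upper bounds «`∀ k, ∃ B_k, β_k ≤ B_k` on `Box γ k`» (the constant may depend on the level; spelled out as a hypothesis
shape throughout, no definition) follow from the uniform (U). [folklore] -/
theorem perLevelUpper_of_betaUpperH {β : HBeta} {β' γ : ℝ} (h : BetaUpperH β' γ β) :
    ∀ k : ℕ, ∃ B : ℝ, ∀ v : Fin (k + 1) → ℝ, v ∈ Box γ k → β k v ≤ B :=
  fun k => ⟨β', fun v hv => h k v hv⟩

/-- Per-level upper bounds restrict to smaller boxes. [folklore] -/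
theorem perLevelUpper_mono {β : HBeta} {γ γ' : ℝ} (hle : γ ≤ γ')
    (h : ∀ k : ℕ, ∃ B : ℝ, ∀ v : Fin (k + 1) → ℝ, v ∈ Box γ' k → β k v ≤ B) :
    ∀ k : ℕ, ∃ B : ℝ, ∀ v : Fin (k + 1) → ℝ, v ∈ Box γ k → β k v ≤ B :=
  fun k => (h k).imp fun _ hB v hv => hB v (box_mono hle k hv)

/-- The TRUNCATION of a family at horizon `K`: `β_j` for `j < K`, the zero function from `K` on (an auxiliary FUNCTION on the tree's
carrier `HBeta`, not a `Prop`; nothing of Bałaban's). [folklore] -/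
def truncH (β : HBeta) (K : ℕ) : HBeta := fun j => if j < K then β j else 0

/-- Below the horizon the truncation is `β`. [folklore] -/
theorem truncH_of_lt {β : HBeta} {K j : ℕ} (h : j < K) : truncH β K j = β j := by
  simp [truncH, h]

/-- From the horizon on the truncation is `0`. [folklore] -/
theorem truncH_of_le {β : HBeta} {K j : ℕ} (h : K ≤ j) : truncH β K j = 0 := by
  simp [truncH, not_lt.mpr h]

/-- (C) transfers to every truncation. [folklore] -/
theorem betaContH_truncH {β : HBeta} {γ : ℝ} (h : BetaContH γ β) (K : ℕ) : BetaContH γ (truncH β K) := by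
  intro j
  by_cases hj : j < K
  · rw [truncH_of_lt hj]; exact h j
  · rw [truncH_of_le (not_lt.mp hj)]; exact continuousOn_const

/-- Per-level bounds make every truncation UNIFORMLY bounded above (by `Σ_{j<K} max(B_j,0) ≥ 0`). [folklore] -/
theorem betaUpperH_truncH {β : HBeta} {γ : ℝ} (h : ∀ k : ℕ, ∃ B : ℝ, ∀ v : Fin (k + 1) → ℝ, v ∈ Box γ k → β k v ≤ B) (K : ℕ) :
    ∃ β' : ℝ, 0 ≤ β' ∧ BetaUpperH β' γ (truncH β K) := by
  classical
  choose B hB using h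
  refine ⟨∑ i ∈ Finset.range K, max (B i) 0, Finset.sum_nonneg fun i _ => le_max_right _ _, fun j v hv => ?_⟩
  by_cases hj : j < K
  · rw [truncH_of_lt hj]
    calc β j v ≤ B j := hB j v hv
      _ ≤ max (B j) 0 := le_max_left _ _
      _ ≤ ∑ i ∈ Finset.range K, max (B i) 0 :=
          Finset.single_le_sum (f := fun i => max (B i) 0) (fun i _ => le_max_right _ _) (Finset.mem_range.mpr hj)
  · rw [truncH_of_le (not_lt.mp hj), Pi.zero_apply]
    exact Finset.sum_nonneg fun i _ => le_max_right _ _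

/-- A `truncH β K`-run, up to `min n K`, is a `β`-run. [folklore] -/
theorem rgEqH_of_truncH {β : HBeta} {K n : ℕ} {gs : ℕ → ℝ} (hrg : RGEqH n (truncH β K) gs) : RGEqH (min n K) β gs := by
  intro k hk
  have h := hrg k (lt_of_lt_of_le hk (min_le_left _ _))
  rwa [truncH_of_lt (lt_of_lt_of_le hk (min_le_right _ _))] at h

/-- In the constant phase `K ≤ j ≤ n` a positive `truncH β K`-run stands still. [folklore] -/
theorem truncH_run_const {β : HBeta} {K n : ℕ} {gs : ℕ → ℝ} {γ : ℝ} (hrg : RGEqH n (truncH β K) gs)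
    (hI : Step.InInterval γ n gs) : ∀ j, K ≤ j → j ≤ n → gs j = gs K := by
  intro j hKj
  induction j, hKj using Nat.le_induction with
  | base => intro; rfl
  | succ j hKj ih =>
      intro hjn
      have hjn' : j ≤ n := (Nat.le_succ j).trans hjn
      have hstep := hrg j (Nat.lt_of_succ_le hjn)
      rw [truncH_of_le hKj, Pi.zero_apply, add_zero, one_div, one_div, inv_inj] at hstep
      have hpj := (hI j hjn').1
      have hpj1 := (hI (j + 1) hjn).1
      have heq : gs (j + 1) = gs j := le_antisymm (by nlinarith) (by nlinarith)
      rw [heq, ih hjn']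

/-- Non-crossing transfers to every truncation. [folklore] -/
theorem hord_truncH {β : HBeta} {γ : ℝ} (K : ℕ)
    (hord : ∀ (n : ℕ) (gs gs' : ℕ → ℝ), RGEqH n β gs → RGEqH n β gs' → Step.InInterval γ n gs → Step.InInterval γ n gs' →
      gs 0 < gs' 0 → ∀ k, k ≤ n → gs k < gs' k) :
    ∀ (n : ℕ) (gs gs' : ℕ → ℝ), RGEqH n (truncH β K) gs → RGEqH n (truncH β K) gs' →
      Step.InInterval γ n gs → Step.InInterval γ n gs' → gs 0 < gs' 0 → ∀ k, k ≤ n → gs k < gs' k := by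
  intro n gs gs' hrg hrg' hI hI' h0 k hk
  have hI₁ : Step.InInterval γ (min n K) gs := fun j hj => hI j (hj.trans (min_le_left _ _))
  have hI₁' : Step.InInterval γ (min n K) gs' := fun j hj => hI' j (hj.trans (min_le_left _ _))
  have hcmp := hord (min n K) gs gs' (rgEqH_of_truncH hrg) (rgEqH_of_truncH hrg') hI₁ hI₁' h0
  by_cases hkK : k ≤ K
  · exact hcmp k (le_min hk hkK)
  · have hKk : K ≤ k := (not_le.mp hkK).le
    rw [truncH_run_const hrg hI k hKk hk, truncH_run_const hrg' hI' k hKk hk]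
    exact hcmp K (le_min (hKk.trans hk) le_rfl)

/-- The top-run bound transfers to every truncation (with the same `g⋆ ≤ γ`). [folklore] -/
theorem topRuns_truncH {β : HBeta} {γ gstar : ℝ} (K : ℕ) (hgγ : gstar ≤ γ)
    (htop : ∀ (n : ℕ) (gs : ℕ → ℝ), RGEqH n β gs → Step.InInterval γ n gs → ∀ k, k ≤ n → gs k = γ → gstar ≤ gs n) :
    ∀ (n : ℕ) (gs : ℕ → ℝ), RGEqH n (truncH β K) gs → Step.InInterval γ n gs → ∀ k, k ≤ n → gs k = γ → gstar ≤ gs n := by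
  intro n gs hrg hI k hk hgk
  have hI₁ : Step.InInterval γ (min n K) gs := fun j hj => hI j (hj.trans (min_le_left _ _))
  by_cases hnK : n ≤ K
  · have h := htop (min n K) gs (rgEqH_of_truncH hrg) hI₁ k (le_min hk (hk.trans hnK)) hgk
    rwa [min_eq_left hnK] at h
  · have hKn : K ≤ n := (not_le.mp hnK).le
    rw [truncH_run_const hrg hI n hKn le_rfl]
    by_cases hkK : k ≤ K
    · have h := htop (min n K) gs (rgEqH_of_truncH hrg) hI₁ k (le_min hk hkK) hgk
      rwa [min_eq_right hKn] at h
    · rw [← truncH_run_const hrg hI k (not_le.mp hkK).le hk, hgk]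
      exact hgγ

/-- **(D)'s ONE-LEVEL CRITERION WITH PER-LEVEL UPPER BOUNDS** (`EndTopRunCriterion.reachable_iff_topRuns` with `BetaUpperH β′ γ β`
weakened to per-level bounds; proof: (D) on the truncations, one horizon at a time). [cite: Balaban1987RG1, Thm 2 p.259] -/
theorem reachable_iff_topRuns_locUpper {β : HBeta} {γ : ℝ} (hγ : 0 < γ) (hcont : BetaContH γ β) (hloc : ∀ k : ℕ, ∃ B : ℝ, ∀ v : Fin (k + 1) → ℝ, v ∈ Box γ k → β k v ≤ B)
    (hord : ∀ (n : ℕ) (gs gs' : ℕ → ℝ), RGEqH n β gs → RGEqH n β gs' → Step.InInterval γ n gs → Step.InInterval γ n gs' →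
      gs 0 < gs' 0 → ∀ k, k ≤ n → gs k < gs' k)
    {gstar : ℝ} (hgstar : 0 < gstar) (hgstarγ : gstar ≤ γ) :
    (∀ (K : ℕ) (g : ℝ), 0 < g → g ≤ gstar → ∃ gs : ℕ → ℝ, gs K = g ∧ RGEqH K β gs ∧ Step.InInterval γ K gs) ↔
    (∀ (n : ℕ) (gs : ℕ → ℝ), RGEqH n β gs → Step.InInterval γ n gs → ∀ k, k ≤ n → gs k = γ → gstar ≤ gs n) := by
  constructor
  · intro hreach n gs hrg hI k hk hgk
    exact le_end_of_topRun hord (fun K => hreach K gstar hgstar le_rfl) hrg hI hk hgk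
  · intro htop K g hg hgle
    obtain ⟨β', hβ', hhi⟩ := betaUpperH_truncH hloc K
    obtain ⟨gs, hK, hrg, hI⟩ := (reachable_iff_topRuns hγ hβ' (betaContH_truncH hcont K) hhi (hord_truncH K hord)
      hgstar hgstarγ).2 (topRuns_truncH K hgstarγ htop) K g hg hgle
    have hrgβ : RGEqH K β gs := by simpa using rgEqH_of_truncH hrg
    exact ⟨gs, hK, hrgβ, hI⟩

/-- **(D)'s END CRITERION AT CONSTRUCTION LEVEL WITH PER-LEVEL UPPER BOUNDS**: `EndTopRunCriterion.endpointExistence_iff_topRuns` with the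
uniform (U) `BetaUpperH β′ γ₀ β` (and its `0 ≤ β′`) replaced by per-level bounds «`∀ k, ∃ B_k, β_k ≤ B_k` on `Box γ₀ k`». [cite: Balaban1987RG1, Thm 2 p.259] -/
theorem endpointExistence_iff_topRuns_locUpper {C : B12.Construction} {β : HBeta} (hgen : ForwardGenerated C β)
    (hhalt : HaltsOutside C β) (hcur : CurriesHBeta C β) {γ₀ : ℝ} (hγ₀ : 0 < γ₀) (hcont : BetaContH γ₀ β)
    (hloc : ∀ k : ℕ, ∃ B : ℝ, ∀ v : Fin (k + 1) → ℝ, v ∈ Box γ₀ k → β k v ≤ B)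
    (hord : ∀ γ : ℝ, 0 < γ → γ ≤ γ₀ → ∀ (n : ℕ) (gs gs' : ℕ → ℝ), RGEqH n β gs → RGEqH n β gs' →
      Step.InInterval γ n gs → Step.InInterval γ n gs' → gs 0 < gs' 0 → ∀ k, k ≤ n → gs k < gs' k) :
    EndpointExistence C ↔
      ∃ γ₂ : ℝ, 0 < γ₂ ∧ ∀ γ : ℝ, 0 < γ → γ ≤ γ₂ → ∃ gstar : ℝ, 0 < gstar ∧
        ∀ (n : ℕ) (gs : ℕ → ℝ), RGEqH n β gs → Step.InInterval γ n gs → ∀ k, k ≤ n → gs k = γ → gstar ≤ gs n := by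
  constructor
  · intro hE
    obtain ⟨γ₂, hγ₂, H⟩ := hE 0
    refine ⟨min γ₂ γ₀, lt_min hγ₂ hγ₀, fun γ hγ hγle => ?_⟩
    obtain ⟨gstar, hgstar, Hg⟩ := H γ hγ (hγle.trans (min_le_left _ _))
    refine ⟨min gstar γ, lt_min hgstar hγ, fun n gs hrg hI k hk hgk => ?_⟩
    have hreach : ∀ K : ℕ, ∃ gs : ℕ → ℝ, gs K = min gstar γ ∧ RGEqH K β gs ∧ Step.InInterval γ K gs := by
      intro K
      obtain ⟨g0, hIK, hK⟩ := Hg (min gstar γ) (lt_min hgstar hγ) (min_le_left _ _) K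
      exact ⟨(C ⟨K, 0, g0⟩).flow.g, hK, rgEqH_of_inInterval hgen hhalt hcur ⟨K, 0, g0⟩ hIK, hIK⟩
    exact le_end_of_topRun (hord γ hγ (hγle.trans (min_le_right _ _))) hreach hrg hI hk hgk
  · rintro ⟨γ₂, hγ₂, H⟩ m
    refine ⟨min γ₂ γ₀, lt_min hγ₂ hγ₀, fun γ hγ hγle => ?_⟩
    have hγ₀le : γ ≤ γ₀ := hγle.trans (min_le_right _ _)
    obtain ⟨gstar, hgstar, htop⟩ := H γ hγ (hγle.trans (min_le_left _ _))
    refine ⟨min gstar γ, lt_min hgstar hγ, fun g hg hgle K => ?_⟩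
    have hcont' : BetaContH γ β := fun k => (hcont k).mono (box_mono hγ₀le k)
    have hloc' := perLevelUpper_mono hγ₀le hloc
    have htop' : ∀ (n : ℕ) (gs : ℕ → ℝ), RGEqH n β gs → Step.InInterval γ n gs →
        ∀ k, k ≤ n → gs k = γ → min gstar γ ≤ gs n :=
      fun n gs hrg hI k hk hgk => (min_le_left _ _).trans (htop n gs hrg hI k hk hgk)
    obtain ⟨gs, hgsK, hrg, hI⟩ := (reachable_iff_topRuns_locUpper hγ hcont' hloc' (hord γ hγ hγ₀le) (lt_min hgstar hγ)
      (min_le_right _ _)).2 htop' K g hg hgle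
    have heq : ∀ k, k ≤ K → (C ⟨K, m, gs 0⟩).flow.g k = gs k :=
      flow_eq_of_rgEqH (C ⟨K, m, gs 0⟩).flow β K (fun k hk => hgen.2 ⟨K, m, gs 0⟩ k hk)
        (hgen.1 ⟨K, m, gs 0⟩) hrg (fun k hk => (hI k hk).1)
    refine ⟨gs 0, fun k hk => ?_, ?_⟩
    · rw [heq k hk]; exact hI k hk
    · rw [heq K le_rfl]; exact hgsK

/-- The same for the canonical construction `modelOf β`: (D)'s `endpointExistence_modelOf_iff_topRuns` with FOUR binders — `0 < γ₀`, (C),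
per-level upper bounds, order — in place of five. [cite: Balaban1987RG1, (0.20) p.256 and Thm 2 p.259] -/
theorem endpointExistence_modelOf_iff_topRuns_locUpper {β : HBeta} {γ₀ : ℝ} (hγ₀ : 0 < γ₀) (hcont : BetaContH γ₀ β)
    (hloc : ∀ k : ℕ, ∃ B : ℝ, ∀ v : Fin (k + 1) → ℝ, v ∈ Box γ₀ k → β k v ≤ B)
    (hord : ∀ γ : ℝ, 0 < γ → γ ≤ γ₀ → ∀ (n : ℕ) (gs gs' : ℕ → ℝ), RGEqH n β gs → RGEqH n β gs' →
      Step.InInterval γ n gs → Step.InInterval γ n gs' → gs 0 < gs' 0 → ∀ k, k ≤ n → gs k < gs' k) :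
    EndpointExistence (modelOf β) ↔
      ∃ γ₂ : ℝ, 0 < γ₂ ∧ ∀ γ : ℝ, 0 < γ → γ ≤ γ₂ → ∃ gstar : ℝ, 0 < gstar ∧
        ∀ (n : ℕ) (gs : ℕ → ℝ), RGEqH n β gs → Step.InInterval γ n gs → ∀ k, k ≤ n → gs k = γ → gstar ≤ gs n :=
  endpointExistence_iff_topRuns_locUpper (modelOf_forwardGenerated β) (modelOf_haltsOutside β) (modelOf_curries β) hγ₀ hcont hloc hord

/-- Under (G)'s two letters the per-level bound is AUTOMATIC: cooperative in the earlier couplings + Lipschitz (constant `M`) in the last one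
give `β_k ≤ β_k(γ₀,…,γ₀) + M·γ₀` on `Box γ₀ k`. [folklore] -/
theorem perLevelUpper_of_cooperative_lastLipschitz {β : HBeta} {γ₀ M : ℝ} (hγ₀ : 0 < γ₀)
    (hcoop : ∀ (k : ℕ) (v v' : Fin (k + 1) → ℝ), v ∈ Box γ₀ k → v' ∈ Box γ₀ k → (∀ i, v i ≤ v' i) →
      v (Fin.last k) = v' (Fin.last k) → β k v ≤ β k v')
    (hlast : ∀ (k : ℕ) (v : Fin (k + 1) → ℝ), v ∈ Box γ₀ k → ∀ x y : ℝ, 0 < x → x ≤ γ₀ → 0 < y → y ≤ γ₀ →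
      |β k (Function.update v (Fin.last k) x) - β k (Function.update v (Fin.last k) y)| ≤ M * |x - y|)
    (hM : 0 ≤ M) : ∀ k : ℕ, ∃ B : ℝ, ∀ v : Fin (k + 1) → ℝ, v ∈ Box γ₀ k → β k v ≤ B := by
  intro k
  set c : Fin (k + 1) → ℝ := fun _ => γ₀ with hc
  have hcbox : c ∈ Box γ₀ k := (mem_box).mpr fun _ => ⟨hγ₀, le_rfl⟩
  refine ⟨β k c + M * γ₀, fun v hv => ?_⟩
  have hvl := (mem_box).mp hv (Fin.last k)
  set u : Fin (k + 1) → ℝ := Function.update c (Fin.last k) (v (Fin.last k)) with hu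
  have hubox : u ∈ Box γ₀ k := by
    refine (mem_box).mpr fun i => ?_
    by_cases hi : i = Fin.last k
    · subst hi; rw [hu, Function.update_self]; exact hvl
    · rw [hu, Function.update_of_ne hi]; exact ⟨hγ₀, le_rfl⟩
  have hle : ∀ i, v i ≤ u i := by
    intro i
    by_cases hi : i = Fin.last k
    · subst hi; rw [hu, Function.update_self]
    · rw [hu, Function.update_of_ne hi]; exact ((mem_box).mp hv i).2
  have hlastEq : v (Fin.last k) = u (Fin.last k) := by rw [hu, Function.update_self]
  have h1 : β k v ≤ β k u := hcoop k v u hv hubox hle hlastEq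
  have h2 := hlast k c hcbox (v (Fin.last k)) γ₀ hvl.1 hvl.2 hγ₀ le_rfl
  rw [Function.update_eq_self] at h2
  have h3 : β k u - β k c ≤ M * γ₀ := by
    have hx : |v (Fin.last k) - γ₀| ≤ γ₀ := by
      rw [abs_sub_comm, abs_of_nonneg (by linarith [hvl.2])]; linarith [hvl.1]
    calc β k u - β k c ≤ |β k u - β k c| := le_abs_self _
      _ ≤ M * |v (Fin.last k) - γ₀| := h2
      _ ≤ M * γ₀ := mul_le_mul_of_nonneg_left hx hM
  linarith

/-! ## §2 The same reading on the W-β road: `FlowStepRuns.endpointExistence_of_partialSums` with per-level upper bounds (kernel §12, ported) -/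

/-- Bounded-below partial sums transfer to every truncation (the tail contributes zeros; `0 ≤ M`). [folklore] -/
theorem betaPartialSumsLowerH_truncH {β : HBeta} {M γ : ℝ} (hM : 0 ≤ M) (hps : BetaPartialSumsLowerH M γ β) (K : ℕ) :
    BetaPartialSumsLowerH M γ (truncH β K) := by
  intro g hg k n hkn
  by_cases hnK : n ≤ K
  · have h1 : ∑ j ∈ Finset.Ico k n, truncH β K j (prefixOf g j) = ∑ j ∈ Finset.Ico k n, β j (prefixOf g j) := by
      refine Finset.sum_congr rfl fun j hj => ?_
      rw [truncH_of_lt (lt_of_lt_of_le (Finset.mem_Ico.mp hj).2 hnK)]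
    rw [h1]; exact hps g hg k n hkn
  · have hKn : K ≤ n := (not_le.mp hnK).le
    by_cases hkK : k ≤ K
    · rw [← Finset.sum_Ico_consecutive _ hkK hKn]
      have h1 : ∑ j ∈ Finset.Ico k K, truncH β K j (prefixOf g j) = ∑ j ∈ Finset.Ico k K, β j (prefixOf g j) := by
        refine Finset.sum_congr rfl fun j hj => ?_
        rw [truncH_of_lt (Finset.mem_Ico.mp hj).2]
      have h2 : ∑ j ∈ Finset.Ico K n, truncH β K j (prefixOf g j) = 0 := by
        refine Finset.sum_eq_zero fun j hj => ?_
        rw [truncH_of_le (Finset.mem_Ico.mp hj).1, Pi.zero_apply]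
      rw [h1, h2, add_zero]; exact hps g hg k K hkK
    · have h2 : ∑ j ∈ Finset.Ico k n, truncH β K j (prefixOf g j) = 0 := by
        refine Finset.sum_eq_zero fun j hj => ?_
        rw [truncH_of_le ((not_le.mp hkK).le.trans (Finset.mem_Ico.mp hj).1), Pi.zero_apply]
      rw [h2]; linarith

/-- **The W-β road with PER-LEVEL upper bounds.**  `FlowStepRuns.endpointExistence_of_partialSums` :593 with `hβ'` GONE and
`hhi : BetaUpperH β′ γ₀ β` replaced by «`∀ k, ∃ B_k, β_k ≤ B_k` on `Box γ₀ k`»; same `g⋆ = (1∕γ² + M)^{−1∕2}`.  Proof: the tree's theorem applied to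
the truncation `truncH β K` at each horizon; its length-`K` runs are `β`-runs. [cite: Balaban1987RG1, Thm 2 p.259 and (0.20) p.256] -/
theorem endpointExistence_of_partialSums_locUpper {C : B12.Construction} {β : HBeta} (hgen : ForwardGenerated C β)
    {γ₀ M : ℝ} (hγ₀ : 0 < γ₀) (hM : 0 ≤ M) (hcont : BetaContH γ₀ β) (hps : BetaPartialSumsLowerH M γ₀ β)
    (hloc : ∀ k : ℕ, ∃ B : ℝ, ∀ v : Fin (k + 1) → ℝ, v ∈ Box γ₀ k → β k v ≤ B) : EndpointExistence C := by
  intro m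
  refine ⟨γ₀, hγ₀, fun γ hγ hγle => ?_⟩
  set gstar : ℝ := 1 / Real.sqrt (1 / γ ^ 2 + M) with hgstar
  have hgstar_pos : 0 < gstar := by positivity
  refine ⟨gstar, hgstar_pos, fun g hg hgle K => ?_⟩
  have hgs : 1 / gstar ^ 2 = 1 / γ ^ 2 + M := by
    rw [hgstar, div_pow, one_pow, Real.sq_sqrt (by positivity), one_div_one_div]
  have hgM : 1 / γ ^ 2 + M ≤ 1 / g ^ 2 := by
    rw [← hgs]
    exact one_div_le_one_div_of_le (by positivity) (pow_le_pow_left₀ hg.le hgle 2)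
  have hcont' : BetaContH γ (truncH β K) := fun k => (betaContH_truncH hcont K k).mono (box_mono hγle k)
  obtain ⟨β', hβ', hhi⟩ := betaUpperH_truncH (perLevelUpper_mono hγle hloc) K
  obtain ⟨gs, hgsK, hrg, hI, -⟩ := couplingTrajectory_exists_partialSums (truncH β K) hγ hM hβ' hcont'
    (betaPartialSumsLowerH_mono hγle (betaPartialSumsLowerH_truncH hM hps K)) hhi K g hg hgM
  have hrgβ : RGEqH K β gs := by
    have h := rgEqH_of_truncH hrg
    rwa [min_self] at h
  have heq : ∀ k, k ≤ K → (C ⟨K, m, gs 0⟩).flow.g k = gs k :=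
    flow_eq_of_rgEqH (C ⟨K, m, gs 0⟩).flow β K (fun k hk => hgen.2 ⟨K, m, gs 0⟩ k hk)
      (hgen.1 ⟨K, m, gs 0⟩) hrgβ (fun k hk => (hI k hk).1)
  refine ⟨gs 0, fun k hk => ?_, ?_⟩
  · rw [heq k hk]; exact hI k hk
  · rw [heq K le_rfl]; exact hgsK

/-- The canonical construction: END of `modelOf β` from {`0 < γ₀`, `0 ≤ M`, (C), partial sums `≥ −M`, per-level upper bounds}. [folklore] -/
theorem endpointExistence_modelOf_of_partialSums_locUpper {β : HBeta} {γ₀ M : ℝ} (hγ₀ : 0 < γ₀) (hM : 0 ≤ M)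
    (hcont : BetaContH γ₀ β) (hps : BetaPartialSumsLowerH M γ₀ β)
    (hloc : ∀ k : ℕ, ∃ B : ℝ, ∀ v : Fin (k + 1) → ℝ, v ∈ Box γ₀ k → β k v ≤ B) : EndpointExistence (modelOf β) :=
  endpointExistence_of_partialSums_locUpper (modelOf_forwardGenerated β) hγ₀ hM hcont hps hloc

/-- The SIGN socket with per-level upper bounds: `DagBinding.endpointExistence_of_forwardGenerated` :628 (β ≥ 0 + (C) + uniform (U),
`0 ≤ β′`) is the case `M = 0` of the W-β road (`betaPartialSumsLowerH_of_sign`), so sign + (C) + PER-LEVEL bounds give END. [cite: Balaban1987RG1, Thm 2 p.259] -/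
theorem endpointExistence_of_sign_locUpper {C : B12.Construction} {β : HBeta} (hgen : ForwardGenerated C β) {γ₀ : ℝ}
    (hγ₀ : 0 < γ₀) (hcont : BetaContH γ₀ β) (hsign : BetaLowerH 0 γ₀ β)
    (hloc : ∀ k : ℕ, ∃ B : ℝ, ∀ v : Fin (k + 1) → ℝ, v ∈ Box γ₀ k → β k v ≤ B) : EndpointExistence C :=
  endpointExistence_of_partialSums_locUpper hgen hγ₀ le_rfl hcont (betaPartialSumsLowerH_of_sign hsign) hloc

end

end Summit.QuantumFields.BalabanUV.Gaps.EndUpperPerLevel
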